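import Summits.QuantumFields.BalabanUV.Beta.CapRowsLattice
import Summits.QuantumFields.BalabanUV.Beta.PolyRegularRestrict

/-!
# Beta / CapRowsLatticeJet — BINDER-OWNERS row CAP-k, item (b): the code16 anchor on the ONE-LOOP FORM at TWO WIDTHS and on the JET FUNCTIONAL
# (β sub-cell, DEDICATED row BETA-an5, lineage `b2b-balaban-beta-an5` = OWNER of row CAP-k; gen 20, prover seat; sibling of `CapRowsLattice`)

HONEST FRAMING (page 1 of everything the β sub-cell writes): discharging `BetaPertH` makes Bałaban's UV stability UNCONDITIONAL — a
real constructive-QFT result; it is NOT the continuum limit and NOT the Clay problem.  HONEST DEPENDENCY (cell reorg 2026-08-19, verbatim):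
«continuum YM on T⁴ ⇐ BetaPertH ∧ nine spine estimates (0/9 proved); BetaPertH ⇐ (D1) ∧ (D4) ∧ CAP+tail; G-an2-4 gates asym, D1 and NE2/3/4.»
THIS MODULE INSTANTIATES NO BINDER.  It composes the lattice-rule anchor `CapRowsLattice.rowsOfCode16E` (engine convention `code16SetE`) and its
certified-road END with cap3-g8's two-width ∕ jet constructors of the (Z) binder (`PolyRegularRestrict.stripRegularC_oneLoopForm₂`,
`stripRegularC_jet_of_bound₂`, p203916; `JetCoefficientCauchy.jetFunctional`, p203751): the (Z1) STRUCTURE (entrywise poly-holomorphy of the five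
matrix families, `det ≠ 0` for the two resolvent families) is certified ONCE at the zero-free half-width `a` (the cell's `a = 9/10`, CAP-KERNEL §7),
while the certified bound and the aliasing tail sit at any `0 < κ ≤ a` (CAP-KERNEL §4.14 (d); the `κ′` rows of `CapLatticeBudget.budget_code16_param`);
and the β-row integrand the engines sum is the JET functional `(1/2)∂₁∂₂ f(q; 0, 0)`, whose bound is the mixed Cauchy estimate `C/(2r²)` from a
uniform certified `C ≥ ‖f‖` on `Strip κ × closedBall r × sphere r`.  Every binder is named by kind in the docstrings: (N) dictionary, STRUCTURE,
(Z1) certificate, (Z2) certificate, (T) two-engine ball, (A) tail majorant (kernel via `CapLatticeBudget`), cmp; plus rate ∕ `hk₂` ∕ (D4) for the END.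
Nothing of Bałaban's is asserted; the cell's actual families live in the engines, not in Lean. [folklore]

ABSOLUTE RULE (cell charter, verbatim): "No internally-minted statement may enter as a cited fact. Every hypothesis is either
kernel-proved in this package or a verbatim quotation of a PUBLISHED theorem with page reference. The manuscript(s) under audit are
NOT citable for their own disputed steps — they are the thing under adjudication; programme-internal (2001/route/tribunal) claims
are never citable."  Nothing is cited here; every statement is a composition of the tree's own leaves.
-/

namespace Summit.QuantumFields.BalabanUV.Beta.CapRowsLatticeJet

open Literature.MathematicalPhysics.QuantumFieldTheory.Balaban1983to89
open Literature.MathematicalPhysics.QuantumFieldTheory.Balaban1983to89.Beta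
open FlowStep FlowStepRuns DagBinding
open B4ContourShift (latticeKernel)
open B4TorusKernel (descend gridPt)
open Beta.RemainderChain (RemainderConst)
open Beta.RateCertificate (GeomRate)
open Beta.AveragedAFCarrier (BetaAvgAFH)
open Beta.AliasingTailL1 (StripRegularC aliasRatioL1)
open Beta.AliasingTailLattice (codeTheta code16SetE)
open Summit.QuantumFields.BalabanUV.Beta.CapRows
open Summit.QuantumFields.BalabanUV.Beta.CapRowsLattice (rowsOfCode16E betaAvgAFH_of_anchorCode16E)

noncomputable section

/-! ## §1 TWO WIDTHS and the JET FUNCTIONAL: structure ⊕ (Z1) once at the zero-free half-width `a`, bound and tail at `κ ≤ a`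

cap3-g8's `PolyRegularRestrict` (p203916) and `JetCoefficientCauchy` (p203751): the (Z1) structure is certified ONCE at the zero-free half-width
`a = 9/10` (CAP-KERNEL §7) while the certified bound `M` and the tail budget may sit at a narrower `κ ≤ a` (§4.14 (d); the `κ′ = 3/5` row of
`CapLatticeBudget.budget_code16_param`); and the β-row integrand the engines sum is the JET functional `(1/2)∂₁∂₂ f(q; 0, 0)` of a three-slot
family, bounded by the mixed Cauchy estimate `C/(2r²)` from a uniform bound `C` of `f` on `Strip κ × closedBall r × sphere r`.  The anchors: -/

section TwoWidths

open Metric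
open Summit.QuantumFields.BalabanUV.Beta.PolyRegularAlgebra (PolyHol MatPolyHol)
open Summit.QuantumFields.BalabanUV.Beta.PolyRegularRestrict (stripRegularC_oneLoopForm₂ stripRegularC_jet_of_bound₂)
open Summit.QuantumFields.BalabanUV.Beta.JetCoefficientCauchy (jetFunctional)

variable {b : ℕ → ℝ} {n : Type*} [Fintype n] [DecidableEq n]
variable {A A' B C D : (Fin 4 → ℂ) → Matrix n n ℂ} {a κ M : ℝ}

/-- **THE ONE-LOOP-FORM ANCHOR AT TWO WIDTHS** (code16, engine convention): STRUCTURE `hA…hBt : MatPolyHol _ (fun _ => a)` and (Z1) `hdet hdet'` on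
`Strip 4 a` ONCE at the zero-free half-width `a`; (Z2) `hM` on `Strip 4 κ`, `0 < κ ≤ a`; (T), (A), cmp at `κ` ⟹ `Rows b`, `k₀ = 0`. [folklore] -/
def rowsOfOneLoopFormCode16E₂
    (hb : b 0 = (latticeKernel (fun p => ((A p)⁻¹ * B p).trace - ((A p)⁻¹ * C p * (A' p)⁻¹ * D p).trace) 0).re)
    (hκ : 0 < κ) (hκa : κ ≤ a) (hA : MatPolyHol A (fun _ => a)) (hA' : MatPolyHol A' (fun _ => a))
    (hBst : MatPolyHol B (fun _ => a)) (hBs : MatPolyHol C (fun _ => a)) (hBt : MatPolyHol D (fun _ => a))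
    (hdet : ∀ p ∈ B4Strip.Strip (3 + 1) a, (A p).det ≠ 0) (hdet' : ∀ p ∈ B4Strip.Strip (3 + 1) a, (A' p).det ≠ 0)
    (hM : ∀ p ∈ B4Strip.Strip (3 + 1) κ, ‖((A p)⁻¹ * B p).trace - ((A p)⁻¹ * C p * (A' p)⁻¹ * D p).trace‖ ≤ M)
    {N : ℕ} (hN : 1 ≤ N) [NeZero (4 * N)] {t r : ℝ}
    (hT : ‖((code16SetE N).card : ℂ)⁻¹ *
        (∑ w ∈ code16SetE N, descend (fun p => ((A p)⁻¹ * B p).trace - ((A p)⁻¹ * C p * (A' p)⁻¹ * D p).trace)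
          (gridPt (4 * N) w)) - t‖ ≤ r)
    {A₀ : ℝ} (hA₀ : M * codeTheta (aliasRatioL1 κ N) ≤ A₀) (lo : ℚ) (hlo : ((lo : ℚ) : ℝ) ≤ t - r - A₀) : Rows b :=
  rowsOfCode16E hb (stripRegularC_oneLoopForm₂ hκ.le hκa hA hA' hBst hBs hBt hdet hdet' hM) hκ hN hT hA₀ lo hlo

variable {β : HBeta}

/-- **THE CERTIFIED ROAD FROM THE TWO-WIDTH ONE-LOOP-FORM ANCHOR.** [folklore] -/
theorem betaAvgAFH_of_oneLoopFormCode16E₂ (S : B12Beta.OneLoopSplit β)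
    (hb : S.β0 0 = (latticeKernel (fun p => ((A p)⁻¹ * B p).trace - ((A p)⁻¹ * C p * (A' p)⁻¹ * D p).trace) 0).re)
    (hκ : 0 < κ) (hκa : κ ≤ a) (hA : MatPolyHol A (fun _ => a)) (hA' : MatPolyHol A' (fun _ => a))
    (hBst : MatPolyHol B (fun _ => a)) (hBs : MatPolyHol C (fun _ => a)) (hBt : MatPolyHol D (fun _ => a))
    (hdet : ∀ p ∈ B4Strip.Strip (3 + 1) a, (A p).det ≠ 0) (hdet' : ∀ p ∈ B4Strip.Strip (3 + 1) a, (A' p).det ≠ 0)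
    (hM : ∀ p ∈ B4Strip.Strip (3 + 1) κ, ‖((A p)⁻¹ * B p).trace - ((A p)⁻¹ * C p * (A' p)⁻¹ * D p).trace‖ ≤ M)
    {N : ℕ} (hN : 1 ≤ N) [NeZero (4 * N)] {t rT : ℝ}
    (hT : ‖((code16SetE N).card : ℂ)⁻¹ *
        (∑ w ∈ code16SetE N, descend (fun p => ((A p)⁻¹ * B p).trace - ((A p)⁻¹ * C p * (A' p)⁻¹ * D p).trace)
          (gridPt (4 * N) w)) - t‖ ≤ rT)
    {A₀ : ℝ} (hA₀ : M * codeTheta (aliasRatioL1 κ N) ≤ A₀) (lo : ℚ) (hlo : ((lo : ℚ) : ℝ) ≤ t - rT - A₀)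
    {γ₀ binf c₀ θ r : ℝ} (hθ0 : 0 ≤ θ) (hθ1 : θ ≤ 1) (hconv : GeomRate S.β0 binf c₀ θ)
    (hk₂ : c₀ * θ ^ (0 + 1) ≤ ((lo : ℝ) - c₀ * θ ^ 0) / 4) (hrem : RemainderConst S γ₀ r) :
    BetaAvgAFH (min ((lo : ℚ) : ℝ) (3 * ((lo : ℝ) - c₀ * θ ^ 0) / 4) - r) 0 γ₀ β :=
  betaAvgAFH_of_anchorCode16E S hb (stripRegularC_oneLoopForm₂ hκ.le hκa hA hA' hBst hBs hBt hdet hdet' hM) hκ hN hT hA₀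
    lo hlo hθ0 hθ1 hconv hk₂ hrem

/-- **THE JET-FUNCTIONAL ANCHOR AT TWO WIDTHS** (code16, engine convention): `G = jetFunctional f = (1/2)∂₁∂₂ f(q; 0, 0)`; STRUCTURE
`hG : PolyHol (jetFunctional f) (fun _ => a)` (from `PolyRegularAlgebra` §2–§3 on the jet-expanded one-loop form); the mixed-Cauchy data at `κ ≤ a`:
`h₂`, `h₁` (holomorphy of the `(p₁, p₂)`-slices on `ball 0 r`) and (Z2) a UNIFORM certified `C ≥ ‖f‖` on `Strip κ × closedBall r × sphere r`; the
tail with `M := C/(2r²)`; (T), cmp ⟹ `Rows b`, `k₀ = 0`. [folklore] -/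
def rowsOfJetCode16E₂ {f : (Fin 4 → ℂ) → ℂ → ℂ → ℂ} {r C : ℝ}
    (hb : b 0 = (latticeKernel (jetFunctional f) 0).re) (hκ : 0 < κ) (hκa : κ ≤ a) (hr : 0 < r)
    (hG : PolyHol (jetFunctional f) (fun _ => a))
    (h₂ : ∀ q ∈ B4Strip.Strip (3 + 1) κ, ∀ p₁ ∈ closedBall (0 : ℂ) r, DiffContOnCl ℂ (f q p₁) (ball 0 r))
    (hC : ∀ q ∈ B4Strip.Strip (3 + 1) κ, ∀ p₁ ∈ closedBall (0 : ℂ) r, ∀ p₂ ∈ sphere (0 : ℂ) r, ‖f q p₁ p₂‖ ≤ C)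
    (h₁ : ∀ q ∈ B4Strip.Strip (3 + 1) κ, DiffContOnCl ℂ (fun p₁ => deriv (f q p₁) 0) (ball 0 r))
    {N : ℕ} (hN : 1 ≤ N) [NeZero (4 * N)] {t rT : ℝ}
    (hT : ‖((code16SetE N).card : ℂ)⁻¹ * (∑ w ∈ code16SetE N, descend (jetFunctional f) (gridPt (4 * N) w)) - t‖ ≤ rT)
    {A₀ : ℝ} (hA₀ : C / (2 * r ^ 2) * codeTheta (aliasRatioL1 κ N) ≤ A₀) (lo : ℚ) (hlo : ((lo : ℚ) : ℝ) ≤ t - rT - A₀) :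
    Rows b :=
  rowsOfCode16E hb (stripRegularC_jet_of_bound₂ hr hκa hG h₂ hC h₁) hκ hN hT hA₀ lo hlo

/-- **THE CERTIFIED ROAD FROM THE JET-FUNCTIONAL ANCHOR.** [folklore] -/
theorem betaAvgAFH_of_jetCode16E₂ (S : B12Beta.OneLoopSplit β) {f : (Fin 4 → ℂ) → ℂ → ℂ → ℂ} {r C : ℝ}
    (hb : S.β0 0 = (latticeKernel (jetFunctional f) 0).re) (hκ : 0 < κ) (hκa : κ ≤ a) (hr : 0 < r)
    (hG : PolyHol (jetFunctional f) (fun _ => a))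
    (h₂ : ∀ q ∈ B4Strip.Strip (3 + 1) κ, ∀ p₁ ∈ closedBall (0 : ℂ) r, DiffContOnCl ℂ (f q p₁) (ball 0 r))
    (hC : ∀ q ∈ B4Strip.Strip (3 + 1) κ, ∀ p₁ ∈ closedBall (0 : ℂ) r, ∀ p₂ ∈ sphere (0 : ℂ) r, ‖f q p₁ p₂‖ ≤ C)
    (h₁ : ∀ q ∈ B4Strip.Strip (3 + 1) κ, DiffContOnCl ℂ (fun p₁ => deriv (f q p₁) 0) (ball 0 r))
    {N : ℕ} (hN : 1 ≤ N) [NeZero (4 * N)] {t rT : ℝ}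
    (hT : ‖((code16SetE N).card : ℂ)⁻¹ * (∑ w ∈ code16SetE N, descend (jetFunctional f) (gridPt (4 * N) w)) - t‖ ≤ rT)
    {A₀ : ℝ} (hA₀ : C / (2 * r ^ 2) * codeTheta (aliasRatioL1 κ N) ≤ A₀) (lo : ℚ) (hlo : ((lo : ℚ) : ℝ) ≤ t - rT - A₀)
    {γ₀ binf c₀ θ r' : ℝ} (hθ0 : 0 ≤ θ) (hθ1 : θ ≤ 1) (hconv : GeomRate S.β0 binf c₀ θ)
    (hk₂ : c₀ * θ ^ (0 + 1) ≤ ((lo : ℝ) - c₀ * θ ^ 0) / 4) (hrem : RemainderConst S γ₀ r') :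
    BetaAvgAFH (min ((lo : ℚ) : ℝ) (3 * ((lo : ℝ) - c₀ * θ ^ 0) / 4) - r') 0 γ₀ β :=
  betaAvgAFH_of_anchorCode16E S hb (stripRegularC_jet_of_bound₂ hr hκa hG h₂ hC h₁) hκ hN hT hA₀ lo hlo hθ0 hθ1 hconv hk₂ hrem

end TwoWidths

end

end Summit.QuantumFields.BalabanUV.Beta.CapRowsLatticeJet
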